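import Summits.QuantumFields.YangMills.Theorems.UnitScaleTiltProp7TPrintDefs
import Literature.Analysis.Complex.RungeBoxes
import Mathlib.Analysis.Complex.ExponentialBounds
import HarnessLib

/-!
# Route `UnitScaleTilt`, crux K1 child «MinimiserStabilityRegPr» (stmt-QuantumFields-19200), skeleton v10, stub `stub_existenceMinimalOrbit`, route (α) (S3)(ii) —
# THE TAYLOR ROWS OF THE RE-CENTRED EXPONENTIAL CHART `D ↦ e^{iD}W` IN THE CELL'S `Y`-LETTERS (orders 1, 2, 3), PROVED

Cell `ym3-torus`, width seat `ym-ust-19200-w4` (gen 0; OWNER 2026-08-28 02:15:05Z choice (x): «the NAIVE exponential chart's TAYLOR-3 row as a PROVED lemma … then (z) the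
re-centred chart `Φ_W` with its differential dictionary `dΦ_W δ ↦ Y`»).  THEOREMS ONLY (0 `def`, 0 `sorry`).  YM₃ on T³ is a ladder rung (R3), not the Clay problem; nothing
here claims the stub, the crux, d = 4 or the mass gap.

WHAT AND WHY.  The cell's PROVED second-order machinery at a background `W` — p1's exact plaquette identity `Prop7ExactExpansion.quarter_hs_plaq_eq` and the (116)-type
coercivity `Prop7CovariantLocalMinimalityRegPr.wilsonAction4_sub_background_ge_of_regPr_T3` — is written in the fluctuation letters `Y(b) = U(b)W(b)^* − 1`.  The
route-(α) chart of [Balaban1985Variational] (112)∕(141)–(142), re-centred at the critical point `W` (p. 299: «the whole procedure with U_k instead of U₀»), is the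
exponential chart `D ↦ e^{iD}W` (`emb15 W (expHermField D)`, `D` Hermitian traceless).  This file PROVES the dictionary between the two, bond by bond, with ABSOLUTE
constants on the unit ball `‖D(b)‖ ≤ 1`:
* `pertY_expChart_eq` — `Y(b) = e^{iD(b)} − 1` (the chart in `Y`-letters);
* `norm_pertY_sub_lin_le` — FIRST-ORDER DICTIONARY `‖Y(b) − iD(b)‖ ≤ ‖D(b)‖²` (`dΦ_W(0)δ = iδ·W`);
* `norm_pertY_sub_quad_le` — SECOND-ORDER ROW `‖Y(b) − iD(b) − ½(iD(b))²‖ ≤ ‖D(b)‖³` (the Taylor-3 remainder of the chart map);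
* `norm_pertY_le` — the size row `‖Y(b)‖ ≤ 2‖D(b)‖` (feeds p1's `hδ`).
§1 is the Banach-algebra lemma behind the second-order row: `norm_exp_sub_one_sub_sub_half_sq_le : ‖x‖ ≤ 1 → ‖exp x − 1 − x − ½x²‖ ≤ ‖x‖³` (exponential series
shifted by three + `Real.exp_bound`), next to the tree's `Literature.Analysis.Complex.norm_exp_sub_one_sub_le` (RungeBoxes, order 2).
LOCATED (what remains for the ACTION-level Taylor-3 row of OWNER 02:05:20Z (b)): compose these bond rows with p1's four-factor word algebra
(`Prop7ExactExpansion.word4_sub_one_sub_lin_eq`, `norm_remainder5_le`) — the exact QUADRATIC part of the plaquette word is the one piece of algebra not yet in the tree.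

HONEST SCOPE.  Elementary Banach-algebra estimates and unfoldings of the tree's letters (`expHerm`, `emb15`); nothing of print is asserted; `--supports stmt-QuantumFields-19200`,
count-neutral.

References: T. Bałaban, CMP 102 (1985) 277–309 [Balaban1985Variational] ((112) p.294, (15) p.280, (19) p.281, (141)–(142) p.299).
-/

set_option autoImplicit false

noncomputable section

open scoped Matrix.Norms.L2Operator

namespace Summit.QuantumFields.YangMills.Theorems.Prop7Taylor3ExpChart

open NormedSpace
open Literature.MathematicalPhysics.QuantumFieldTheory.Balaban1983to89
open Literature.MathematicalPhysics.QuantumFieldTheory.Balaban1983to89.T3ContinuumYM3Torus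
open Literature.MathematicalPhysics.QuantumFieldTheory.Balaban1983to89.T3SectALandauChart (emb15)
open Summit.QuantumFields.YangMills.Theorems.Prop7TPrint (expHerm coe_expHerm expHermField expHermField_apply)

/-! ## §1 The third-order remainder of the exponential in a complex Banach algebra -/

/-- **Third-order Taylor remainder of `exp`**: `‖exp x − 1 − x − ½x²‖ ≤ e^{‖x‖} − 1 − ‖x‖ − ½‖x‖² ≤ ‖x‖³` for `‖x‖ ≤ 1` (series shifted by three; `Real.exp_bound`).
[folklore] -/
theorem norm_exp_sub_one_sub_sub_half_sq_le {𝔄 : Type*} [NormedRing 𝔄] [NormedAlgebra ℂ 𝔄] [CompleteSpace 𝔄] {x : 𝔄} (hx : ‖x‖ ≤ 1) :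
    ‖exp x - 1 - x - (2 : ℂ)⁻¹ • x ^ 2‖ ≤ ‖x‖ ^ 3 := by
  have h1 : HasSum (fun n ↦ ((Nat.factorial n : ℂ)⁻¹) • x ^ n) (exp x) := exp_series_hasSum_exp' (𝕂 := ℂ) x
  have h2 : HasSum (fun n : ℕ ↦ ((Nat.factorial (n + 3) : ℂ)⁻¹) • x ^ (n + 3)) (exp x - 1 - x - (2 : ℂ)⁻¹ • x ^ 2) := by
    have h := (hasSum_nat_add_iff' 3).2 h1
    simp only [Finset.sum_range_succ, Finset.sum_range_zero, Nat.factorial_zero, Nat.cast_one, inv_one, pow_zero, one_smul, zero_add,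
      Nat.factorial_one, pow_one, Nat.factorial_two, Nat.cast_ofNat] at h
    have e : exp x - (1 + x + (2 : ℂ)⁻¹ • x ^ 2) = exp x - 1 - x - (2 : ℂ)⁻¹ • x ^ 2 := by abel
    rwa [e] at h
  have h1' : HasSum (fun n ↦ ((Nat.factorial n : ℝ)⁻¹) • ‖x‖ ^ n) (Real.exp ‖x‖) := by
    rw [Real.exp_eq_exp_ℝ]
    exact exp_series_hasSum_exp' (𝕂 := ℝ) ‖x‖
  have h3 : HasSum (fun n : ℕ ↦ ((Nat.factorial (n + 3) : ℝ)⁻¹) * ‖x‖ ^ (n + 3)) (Real.exp ‖x‖ - 1 - ‖x‖ - 2⁻¹ * ‖x‖ ^ 2) := by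
    have h := (hasSum_nat_add_iff' 3).2 h1'
    simp only [Finset.sum_range_succ, Finset.sum_range_zero, Nat.factorial_zero, Nat.cast_one, inv_one, pow_zero, zero_add, Nat.factorial_one,
      pow_one, Nat.factorial_two, Nat.cast_ofNat, smul_eq_mul, one_mul] at h
    have e : Real.exp ‖x‖ - (1 + ‖x‖ + 2⁻¹ * ‖x‖ ^ 2) = Real.exp ‖x‖ - 1 - ‖x‖ - 2⁻¹ * ‖x‖ ^ 2 := by ring
    rwa [e] at h
  have h4 : ∀ n : ℕ, ‖((Nat.factorial (n + 3) : ℂ)⁻¹) • x ^ (n + 3)‖ ≤ ((Nat.factorial (n + 3) : ℝ)⁻¹) * ‖x‖ ^ (n + 3) := by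
    intro n
    rw [norm_smul, norm_inv, Complex.norm_natCast]
    exact mul_le_mul_of_nonneg_left (norm_pow_le' _ (by omega)) (by positivity)
  have h5 : Real.exp ‖x‖ - 1 - ‖x‖ - 2⁻¹ * ‖x‖ ^ 2 ≤ ‖x‖ ^ 3 := by
    have hb := Real.exp_bound (x := ‖x‖) (by rwa [abs_of_nonneg (norm_nonneg _)]) (n := 3) (by norm_num)
    simp only [Finset.sum_range_succ, Finset.sum_range_zero, Nat.cast_one, pow_zero, zero_add, pow_one,
      Nat.cast_ofNat, div_one, Nat.factorial, Nat.succ_eq_add_one] at hb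
    rw [abs_of_nonneg (norm_nonneg _)] at hb
    have h6 := (le_abs_self _).trans hb
    have h7 : (0 : ℝ) ≤ ‖x‖ ^ 3 := by positivity
    norm_num at h6
    nlinarith [h6, h7]
  exact (h2.norm_le_of_bounded h3 h4).trans h5

/-- `‖exp x − 1‖ ≤ 2‖x‖` for `‖x‖ ≤ 1` (from the tree's second-order remainder `‖exp x − 1 − x‖ ≤ ‖x‖²`). [folklore] -/
theorem norm_exp_sub_one_le_two_mul {𝔄 : Type*} [NormedRing 𝔄] [NormedAlgebra ℂ 𝔄] [CompleteSpace 𝔄] [NormOneClass 𝔄] {x : 𝔄} (hx : ‖x‖ ≤ 1) :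
    ‖exp x - 1‖ ≤ 2 * ‖x‖ := by
  have h := Literature.Analysis.Complex.norm_exp_sub_one_sub_le hx
  have e : exp x - 1 = (exp x - 1 - x) + x := by abel
  have hx2 : ‖x‖ ^ 2 ≤ ‖x‖ := by nlinarith [norm_nonneg x]
  calc ‖exp x - 1‖ = ‖(exp x - 1 - x) + x‖ := by rw [← e]
    _ ≤ ‖exp x - 1 - x‖ + ‖x‖ := norm_add_le _ _
    _ ≤ 2 * ‖x‖ := by linarith

/-! ## §2 The exponential chart at a background in `Y`-letters, bond by bond -/

variable {F : T3Family} {K : ℕ}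

/-- **THE CHART IN `Y`-LETTERS**: for `D(b)` Hermitian traceless, the fluctuation of `e^{iD}W` relative to `W` at the bond `b` is `Y(b) = (e^{iD}W)(b)·W(b)^* − 1 = e^{iD(b)} − 1`.
[cite: Balaban1985Variational, (112) p.294, (15) p.280] -/
theorem pertY_expChart_eq (W : GaugeField (F.P K) 0 (Matrix.specialUnitaryGroup (Fin 2) ℂ)) (D : PBond (F.P K) 0 → Matrix (Fin 2) (Fin 2) ℂ)
    (b : PBond (F.P K) 0) (hD : (D b).IsHermitian ∧ Matrix.trace (D b) = 0) :
    ((emb15 W (expHermField D) b : Matrix.specialUnitaryGroup (Fin 2) ℂ) : Matrix (Fin 2) (Fin 2) ℂ) * star ((W b : Matrix.specialUnitaryGroup (Fin 2) ℂ) : Matrix (Fin 2) (Fin 2) ℂ) - 1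
      = exp (Complex.I • D b) - 1 := by
  have hW : ((W b : Matrix.specialUnitaryGroup (Fin 2) ℂ) : Matrix (Fin 2) (Fin 2) ℂ) * star ((W b : Matrix.specialUnitaryGroup (Fin 2) ℂ) : Matrix (Fin 2) (Fin 2) ℂ) = 1 :=
    Matrix.mem_unitaryGroup_iff.mp (W b).prop.1
  have e1 : ((emb15 W (expHermField D) b : Matrix.specialUnitaryGroup (Fin 2) ℂ) : Matrix (Fin 2) (Fin 2) ℂ)
      = ((expHerm (D b) : Matrix.specialUnitaryGroup (Fin 2) ℂ) : Matrix (Fin 2) (Fin 2) ℂ) * ((W b : Matrix.specialUnitaryGroup (Fin 2) ℂ) : Matrix (Fin 2) (Fin 2) ℂ) := by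
    simp only [emb15, expHermField_apply]; rfl
  rw [e1, mul_assoc, hW, mul_one, coe_expHerm hD]

/-- `‖iD‖ = ‖D‖` for the `L²`-operator norm. [folklore] -/
theorem norm_I_smul (D : Matrix (Fin 2) (Fin 2) ℂ) : ‖Complex.I • D‖ = ‖D‖ := by
  rw [norm_smul, Complex.norm_I, one_mul]

/-- **FIRST-ORDER DICTIONARY** `dΦ_W(0)δ = iδ·W`: `‖Y(b) − iD(b)‖ ≤ ‖D(b)‖²` on `‖D(b)‖ ≤ 1`. [cite: Balaban1985Variational, (112) p.294, (22) p.281] -/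
theorem norm_pertY_sub_lin_le (W : GaugeField (F.P K) 0 (Matrix.specialUnitaryGroup (Fin 2) ℂ)) (D : PBond (F.P K) 0 → Matrix (Fin 2) (Fin 2) ℂ)
    (b : PBond (F.P K) 0) (hD : (D b).IsHermitian ∧ Matrix.trace (D b) = 0) (h1 : ‖D b‖ ≤ 1) :
    ‖((emb15 W (expHermField D) b : Matrix.specialUnitaryGroup (Fin 2) ℂ) : Matrix (Fin 2) (Fin 2) ℂ) * star ((W b : Matrix.specialUnitaryGroup (Fin 2) ℂ) : Matrix (Fin 2) (Fin 2) ℂ) - 1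
        - Complex.I • D b‖ ≤ ‖D b‖ ^ 2 := by
  rw [pertY_expChart_eq W D b hD, ← norm_I_smul (D b)]
  exact Literature.Analysis.Complex.norm_exp_sub_one_sub_le (by rwa [norm_I_smul])

/-- **SECOND-ORDER ROW (Taylor-3 remainder of the chart map)**: `‖Y(b) − iD(b) − ½(iD(b))²‖ ≤ ‖D(b)‖³` on `‖D(b)‖ ≤ 1`. [cite: Balaban1985Variational, (112) p.294, (141)-(142) p.299] -/
theorem norm_pertY_sub_quad_le (W : GaugeField (F.P K) 0 (Matrix.specialUnitaryGroup (Fin 2) ℂ)) (D : PBond (F.P K) 0 → Matrix (Fin 2) (Fin 2) ℂ)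
    (b : PBond (F.P K) 0) (hD : (D b).IsHermitian ∧ Matrix.trace (D b) = 0) (h1 : ‖D b‖ ≤ 1) :
    ‖((emb15 W (expHermField D) b : Matrix.specialUnitaryGroup (Fin 2) ℂ) : Matrix (Fin 2) (Fin 2) ℂ) * star ((W b : Matrix.specialUnitaryGroup (Fin 2) ℂ) : Matrix (Fin 2) (Fin 2) ℂ) - 1
        - Complex.I • D b - (2 : ℂ)⁻¹ • (Complex.I • D b) ^ 2‖ ≤ ‖D b‖ ^ 3 := by
  rw [pertY_expChart_eq W D b hD, ← norm_I_smul (D b)]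
  exact norm_exp_sub_one_sub_sub_half_sq_le (by rwa [norm_I_smul])

/-- **SIZE ROW** (feeds p1's `hδ`): `‖Y(b)‖ ≤ 2‖D(b)‖` on `‖D(b)‖ ≤ 1`. [cite: Balaban1985Variational, (19) p.281, (22) p.281] -/
theorem norm_pertY_le (W : GaugeField (F.P K) 0 (Matrix.specialUnitaryGroup (Fin 2) ℂ)) (D : PBond (F.P K) 0 → Matrix (Fin 2) (Fin 2) ℂ)
    (b : PBond (F.P K) 0) (hD : (D b).IsHermitian ∧ Matrix.trace (D b) = 0) (h1 : ‖D b‖ ≤ 1) :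
    ‖((emb15 W (expHermField D) b : Matrix.specialUnitaryGroup (Fin 2) ℂ) : Matrix (Fin 2) (Fin 2) ℂ) * star ((W b : Matrix.specialUnitaryGroup (Fin 2) ℂ) : Matrix (Fin 2) (Fin 2) ℂ) - 1‖
      ≤ 2 * ‖D b‖ := by
  rw [pertY_expChart_eq W D b hD, ← norm_I_smul (D b)]
  exact norm_exp_sub_one_le_two_mul (by rwa [norm_I_smul])

/-- **THE SIZE ROW, FIELD-WIDE, IN p1's SHAPE**: if `‖D(b)‖ ≤ s ≤ 1` on every bond then `‖Y(b)‖ ≤ 2s` on every bond — the hypothesis `hδ` of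
`Prop7CovariantLocalMinimalityRegPr.wilsonAction4_sub_background_ge_of_regPr_T3` at background `W` with `ε₂L^{−(K−n)} := 2s`. [cite: Balaban1985Variational, (19) p.281] -/
theorem norm_pertY_le_of_sup (W : GaugeField (F.P K) 0 (Matrix.specialUnitaryGroup (Fin 2) ℂ)) (D : PBond (F.P K) 0 → Matrix (Fin 2) (Fin 2) ℂ)
    (hD : ∀ b : PBond (F.P K) 0, (D b).IsHermitian ∧ Matrix.trace (D b) = 0) {s : ℝ} (hs : ∀ b : PBond (F.P K) 0, ‖D b‖ ≤ s) (hs1 : s ≤ 1) :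
    ∀ b : PBond (F.P K) 0,
      ‖((emb15 W (expHermField D) b : Matrix.specialUnitaryGroup (Fin 2) ℂ) : Matrix (Fin 2) (Fin 2) ℂ) * star ((W b : Matrix.specialUnitaryGroup (Fin 2) ℂ) : Matrix (Fin 2) (Fin 2) ℂ) - 1‖
        ≤ 2 * s := by
  intro b
  exact (norm_pertY_le W D b (hD b) ((hs b).trans hs1)).trans (by linarith [hs b])

end Summit.QuantumFields.YangMills.Theorems.Prop7Taylor3ExpChart

end
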